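/-
COR-CM (cell pub-hodgecm2) — the μ ↦ μᶜ IDENTIFICATION, ω-SIDE, AT THE END's ROW (d2bridge-ref G60 §5 (R2); PLANNER-A a6/a10; Ω ROW TABLE
rows Ω-VII/VIII): the displayed `hLiuC` row ⇔ [Liu2021, Thm. 4.18] AS PRINTED at the CONJUGATE SPACE's transported datum.  PART VII of
RSCONJ row Ω.  Seat prover-pub-hodgeaudit-ident-1-g4-0 (ident-1 GEN 4, Ω lead), checker ident-2, 2026-08-24.  KERNEL ONLY: three small
definitions by explicit formula (`repNegTwist`, `repConj`, `epsNegEquiv`) + theorems; no named fact, no instance, no `sorry`.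
HC_CM is NOT proved; HELD — WORLD = C FINAL; nothing displayed by an END is discharged here.
-/
import Literature.NumberTheory.Automorphic.Liu2021.Thm418Transport
import Summits.HodgeConjecture.CorCM.D2Bridge.AdapterMuConj
import Summits.HodgeConjecture.CorCM.B01.Transposition.HComp.RecordSystemConjOmegaTwistModel
import HarnessLib

set_option autoImplicit false

/-!
# The END's `hLiuC` row ⇔ Thm 4.18 AS PRINTED at the conjugate space's transported datum

`hLiuC` (✔ `D2Bridge/ClosedPrintedMuKeyDelRec.lean` :73–:76 and its lineage) displays, at a face `(F, ι₁, V, Φ)` and a conjugate-symplectic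
`ν`, `Thm418AsPrinted (toThm418Data ℭ ((AdapterMuConj.muConj 𝕌).rest t))` (`ℭ := sec42DataOf h isoOf F ι₁ V Φ`, `𝕌 := uniformOmegaRep … V Φ e dV
hdV hdV0 ιV δ′ r`, `t` the tail at `ν`): Weil side = `𝕌`'s summands at the label `νᶜ` (`muConj_omega`, `rfl`), collections map at `−e` — the
RELABELLING read so far as (iv-c).  This file proves in the kernel:
* §1 (generic; any App.-C datum `C`, `U : UniformOmega C`, tail `t`, topological-group isomorphism `φ : G′ ≃ₜ* C.G`, index bijections
  `eε : Eps′ ≃ U.Eps`, `eχ : Chi′ ≃ U.Chi`, collections map `epsOf′` with `U.epsOf (−x) = eε (epsOf′ x)` on admissible `x`, summand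
  isomorphisms `Ω`/`Ω′` equivariant along `φ`): `thm418AsPrinted_muConj_rest_transport` (forward, ONE application of ✔ (P3)
  `Thm418Data.thm418AsPrinted_transport`, index bijection `(ε′, χ′) ↦ (eε ε′, eχ χ′)`) and `thm418AsPrinted_muConj_rest_of_transport`
  (backward, ✔ `Thm418Data.thm418AsPrinted_of_transport`).
* §2 (the face of record): `repNegTwist`/`repConj` (`rᶜ_ν(ε′) := −r_{νᶜ}(−ε′)`, faithful again), `epsNegEquiv` (`ε ↦ locF(−1)·ε`),
  `epsOf_neg_of_complexConj_eq_neg` ([Def. 4.12] last sentence on collections: `epsOf δ′ (−x) = locF (−1) · epsOf δ′ x` for `x̄ = −x ≠ 0`), and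
  **`thm418AsPrinted_muConj_rest_iff_transport_hermConj`**: for EVERY tail `t`,
  `Thm418AsPrinted (toThm418Data ℭ ((muConj 𝕌).rest t)) ↔ Thm418AsPrinted ((toThm418Data ℭ ((muConj 𝕌).rest t)).transport 𝔾_{V^{(c)}} (adelicFinConj V)⁻¹ Eps (epsOf … δ′) Chi (𝕌_{V^{(c)}}.omega ν hν) (𝕌_{V^{(c)}}.rho ν hν))`,
  `𝕌_{V^{(c)}} := uniformOmegaRep h F ι₁ V.conj Φ′ e dV hdV hdV0 (iotaVConj … ιV hJc) δ′ (repConj F r)` = the CONJUGATE SPACE's own μ-uniform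
  [Def. 4.11 ∕ 4.12] family at the label `ν` (row B ✔ `HermSpace3.conj`; Part VI ✔ `exists_uniformOmegaRep_conj_hermConj`), the group
  `U(V^{(c)})(𝔸_{F⁺,f})` acting natively (on `Ω(ν)` and the levels through `g ↦ ḡ`), Liu's OWN collections map (no `−e`).
READING (for the referees; not a verdict): the END's row at `(V, ν)` is KERNEL-EQUIVALENT to [Thm. 4.18] AS PRINTED for `(X, ν)`, `X = ℭ.X
= M^{(c)} ≅ X(V^{(c)})` (space face ✔ R10 + R6) natively presented, with the conjugate space's own oscillator family; residue (print level):
(α) that family sits on the frame `dV` of `V` through `ιVᶜ` (row B `frameTwist`), (β) [Def. 4.11] transcription, (γ) [Thm. 4.18] itself.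
References: [Liu2021] Thm. 4.18 (l. 2232–2245), Def. 4.11 (l. 2083–2097), Def. 4.12 (l. 2102–2111), Rem. 4.4 (l. 1912–1933), App. D
Lem. D.1 (2) (l. 5231); [GelbartRogawski1991] §3.1; [Kudla1996] V.3; [PlatonovRapinchuk1994] §5.1.
-/

noncomputable section

open scoped Matrix
open NumberField IsDedekindDomain
open Literature.NumberTheory.Automorphic Literature.NumberTheory.Automorphic.UnitaryGroup Literature.NumberTheory.Automorphic.IdeleClassGroup
open Literature.NumberTheory.Automorphic.Liu2021 Literature.NumberTheory.Automorphic.Liu2021.AppendixC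
open Literature.NumberTheory.Automorphic.Liu2021.Def411WeilCarriers (Eps locF epsOf Chi Rep epsOf_algebraMap_mul)
open Literature.NumberTheory.GelbartRogawski1991.UnitaryDualPair (imagUnitSq)
open Literature.AlgebraicGeometry.Liu2021 (IsAdmissibleElement)
open Literature.AlgebraicGeometry.Motives (CMType)
open Literature.AlgebraicGeometry.ShimuraVarieties.UnitaryCanonicalModel
open Summit.HodgeConjecture.CorCM.Transposition Summit.HodgeConjecture.CorCM.Model Summit.HodgeConjecture.CorCM.HComp.OmegaConj

namespace Summit.HodgeConjecture.CorCM.D2Bridge.MuConjIdent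

/-! ## §1 Generic: the `hLiuC`-shaped row transports along any re-presentation of the group and of the oscillator side -/

section Generic

variable {F E : Type} {iF₁ : Field F} {iF₂ : NumberField F} {iF₃ : IsTotallyReal F} {iE₁ : Field E} {iE₂ : NumberField E}
  {iA : Algebra F E} {iE₃ : IsTotallyComplex E} {iQ : Algebra.IsQuadraticExtension F E}
variable {P5 : PropC5Data F E} {isotropicAt : ℕ → Prop} {C : Sec42Data P5 isotropicAt}

/-- **FORWARD (generic)**: [Liu2021, Thm. 4.18] AS PRINTED for the relabelled rest `(muConj U).rest t` implies it for the datum transported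
along `φ : G′ ≃ₜ* 𝔾(𝔸_F^∞)` to the index types `Eps′, Chi′`, collections map `epsOf′` and summands `ω′ ε′ χ′ ≅ U.omega νᶜ (eε ε′) (eχ χ′)`;
index bijection `(ε′, χ′) ↦ (eε ε′, eχ χ′)` ([Def. 4.12]: `ε` is `μ`-admissible iff `−ε` is `μᶜ`-admissible, via `hneg`).
[cite: Liu2021, Thm. 4.18 (l. 2232–2245), Def. 4.12 (l. 2102–2111), Rem. 4.4] -/
theorem thm418AsPrinted_muConj_rest_transport (U : UniformOmega C)
    {ν : Literature.NumberTheory.Automorphic.IdeleClassGroup E →ₜ* Circle}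
    {hν : letI : IsCMField E := isCMField F E; IdeleClassGroup.IsConjugateSymplectic E ν} (t : RestTail C ν hν)
    (G' : Type) [Group G'] [TopologicalSpace G'] [IsTopologicalGroup G'] (φ : G' ≃ₜ* C.G)
    (Eps' : Type) (epsOf' : E → Eps') (Chi' : Type) (omega' : Eps' → Chi' → Type)
    [∀ ε χ, AddCommGroup (omega' ε χ)] [∀ ε χ, Module ℂ (omega' ε χ)]
    (rho' : ∀ ε χ, Representation ℂ G' (omega' ε χ))
    (eε : Eps' ≃ U.Eps) (eχ : Chi' ≃ U.Chi)
    (hneg : ∀ x : E, (letI : IsCMField E := isCMField F E;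
        IsAdmissibleElement E (AppendixC.toThm418Data C ((AdapterMuConj.muConj U).rest t)).cmType.1 x) →
        U.epsOf (-x) = eε (epsOf' x))
    (Ω : ∀ ε χ, U.omega _ (letI : IsCMField E := isCMField F E; hν.galConj) (eε ε) (eχ χ) ≃ₗ[ℂ] omega' ε χ)
    (hΩ : ∀ ε χ (g' : G') (x : U.omega _ (letI : IsCMField E := isCMField F E; hν.galConj) (eε ε) (eχ χ)),
      Ω ε χ (U.rho _ _ (eε ε) (eχ χ) (φ g') x) = rho' ε χ g' (Ω ε χ x))
    (hrow : Thm418AsPrinted (AppendixC.toThm418Data C ((AdapterMuConj.muConj U).rest t))) :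
    Thm418AsPrinted ((AppendixC.toThm418Data C ((AdapterMuConj.muConj U).rest t)).transport G' φ Eps' epsOf' Chi'
      omega' rho') := by
  letI : IsCMField E := isCMField F E
  -- [Def. 4.12] on collections: admissibility at the two collection maps corresponds under `eε`
  have hadm_iff : ∀ ε' : Eps',
      ((AppendixC.toThm418Data C ((AdapterMuConj.muConj U).rest t)).transport G' φ Eps' epsOf' Chi' omega'
          rho').IsAdmissible ε' ↔
        (AppendixC.toThm418Data C ((AdapterMuConj.muConj U).rest t)).IsAdmissible (eε ε') := by
    intro ε'
    constructor
    · rintro ⟨x, hx, hxε⟩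
      refine ⟨x, hx, ?_⟩
      change U.epsOf (-x) = eε ε'
      rw [hneg x hx]
      exact congrArg eε hxε
    · rintro ⟨x, hx, hxε⟩
      refine ⟨x, hx, eε.injective ?_⟩
      change eε (epsOf' x) = eε ε'
      change U.epsOf (-x) = eε ε' at hxε
      rw [← hneg x hx]
      exact hxε
  -- the index bijection `(ε′, χ′) ↦ (eε ε′, eχ χ′)`
  let e : ((AppendixC.toThm418Data C ((AdapterMuConj.muConj U).rest t)).transport G' φ Eps' epsOf' Chi' omega'
        rho').AdmIndex ≃ (AppendixC.toThm418Data C ((AdapterMuConj.muConj U).rest t)).AdmIndex :=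
    { toFun := fun i' => ⟨(eε i'.1.1, eχ i'.1.2), (hadm_iff _).1 i'.2⟩
      invFun := fun i => ⟨(eε.symm i.1.1, eχ.symm i.1.2), (hadm_iff _).2 (by rw [Equiv.apply_symm_apply]; exact i.2)⟩
      left_inv := fun i' => Subtype.ext (Prod.ext (eε.symm_apply_apply _) (eχ.symm_apply_apply _))
      right_inv := fun i => Subtype.ext (Prod.ext (eε.apply_symm_apply _) (eχ.apply_symm_apply _)) }
  refine Thm418Data.thm418AsPrinted_transport (AppendixC.toThm418Data C ((AdapterMuConj.muConj U).rest t)) G' φ Eps'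
    epsOf' Chi' omega' rho' hrow e (fun ε' => eε ε') eε.injective (fun _ => rfl) (fun ε' h => (hadm_iff ε').1 h)
    (fun i' => (Ω i'.1.1 i'.1.2).symm) ?_
  intro i' g' y
  change (Ω i'.1.1 i'.1.2).symm (rho' i'.1.1 i'.1.2 g' y) =
    U.rho _ hν.galConj (eε i'.1.1) (eχ i'.1.2) (φ g') ((Ω i'.1.1 i'.1.2).symm y)
  rw [LinearEquiv.symm_apply_eq, hΩ, LinearEquiv.apply_symm_apply]

/-- **BACKWARD (generic)**: [Liu2021, Thm. 4.18] AS PRINTED for the transported datum implies it for `(muConj U).rest t`, given the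
inverse summand isomorphisms `Ω′ ε₀ χ₀ : U.omega νᶜ ε₀ χ₀ ≃ₗ ω′ (eε⁻¹ ε₀) (eχ⁻¹ χ₀)`; ONE application of ✔ `Thm418Data.thm418AsPrinted_of_transport`
(round trip `transport φ⁻¹ ∘ transport φ = id`). [cite: Liu2021, Thm. 4.18 (l. 2232–2245), Def. 4.12 (l. 2102–2111), Rem. 4.4] -/
theorem thm418AsPrinted_muConj_rest_of_transport (U : UniformOmega C)
    {ν : Literature.NumberTheory.Automorphic.IdeleClassGroup E →ₜ* Circle}
    {hν : letI : IsCMField E := isCMField F E; IdeleClassGroup.IsConjugateSymplectic E ν} (t : RestTail C ν hν)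
    (G' : Type) [Group G'] [TopologicalSpace G'] [IsTopologicalGroup G'] (φ : G' ≃ₜ* C.G)
    (Eps' : Type) (epsOf' : E → Eps') (Chi' : Type) (omega' : Eps' → Chi' → Type)
    [∀ ε χ, AddCommGroup (omega' ε χ)] [∀ ε χ, Module ℂ (omega' ε χ)]
    (rho' : ∀ ε χ, Representation ℂ G' (omega' ε χ))
    (eε : Eps' ≃ U.Eps) (eχ : Chi' ≃ U.Chi)
    (hneg : ∀ x : E, (letI : IsCMField E := isCMField F E;
        IsAdmissibleElement E (AppendixC.toThm418Data C ((AdapterMuConj.muConj U).rest t)).cmType.1 x) →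
        U.epsOf (-x) = eε (epsOf' x))
    (Ω' : ∀ ε₀ χ₀, U.omega _ (letI : IsCMField E := isCMField F E; hν.galConj) ε₀ χ₀ ≃ₗ[ℂ] omega' (eε.symm ε₀) (eχ.symm χ₀))
    (hΩ' : ∀ ε₀ χ₀ (g' : G') (x : U.omega _ (letI : IsCMField E := isCMField F E; hν.galConj) ε₀ χ₀),
      Ω' ε₀ χ₀ (U.rho _ _ ε₀ χ₀ (φ g') x) = rho' _ _ g' (Ω' ε₀ χ₀ x))
    (h' : Thm418AsPrinted ((AppendixC.toThm418Data C ((AdapterMuConj.muConj U).rest t)).transport G' φ Eps' epsOf' Chi'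
      omega' rho')) :
    Thm418AsPrinted (AppendixC.toThm418Data C ((AdapterMuConj.muConj U).rest t)) := by
  letI : IsCMField E := isCMField F E
  have hadm_iff : ∀ ε₀ : U.Eps,
      (AppendixC.toThm418Data C ((AdapterMuConj.muConj U).rest t)).IsAdmissible ε₀ ↔
        ((AppendixC.toThm418Data C ((AdapterMuConj.muConj U).rest t)).transport G' φ Eps' epsOf' Chi' omega'
          rho').IsAdmissible (eε.symm ε₀) := by
    intro ε₀
    constructor
    · rintro ⟨x, hx, hxε⟩
      refine ⟨x, hx, eε.injective ?_⟩
      change eε (epsOf' x) = eε (eε.symm ε₀)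
      change U.epsOf (-x) = ε₀ at hxε
      rw [← hneg x hx, Equiv.apply_symm_apply]
      exact hxε
    · rintro ⟨x, hx, hxε⟩
      refine ⟨x, hx, ?_⟩
      change U.epsOf (-x) = ε₀
      rw [hneg x hx]
      exact (congrArg eε hxε).trans (eε.apply_symm_apply ε₀)
  let e : (AppendixC.toThm418Data C ((AdapterMuConj.muConj U).rest t)).AdmIndex ≃
      ((AppendixC.toThm418Data C ((AdapterMuConj.muConj U).rest t)).transport G' φ Eps' epsOf' Chi' omega'
        rho').AdmIndex :=
    { toFun := fun i => ⟨(eε.symm i.1.1, eχ.symm i.1.2), (hadm_iff _).1 i.2⟩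
      invFun := fun i' => ⟨(eε i'.1.1, eχ i'.1.2), (hadm_iff _).2 (by rw [Equiv.symm_apply_apply]; exact i'.2)⟩
      left_inv := fun i => Subtype.ext (Prod.ext (eε.apply_symm_apply _) (eχ.apply_symm_apply _))
      right_inv := fun i' => Subtype.ext (Prod.ext (eε.symm_apply_apply _) (eχ.symm_apply_apply _)) }
  refine Thm418Data.thm418AsPrinted_of_transport (AppendixC.toThm418Data C ((AdapterMuConj.muConj U).rest t)) G' φ
    Eps' epsOf' Chi' omega' rho' h' e (fun ε₀ => eε.symm ε₀) eε.symm.injective (fun _ => rfl)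
    (fun ε₀ h => (hadm_iff ε₀).1 h) (fun i => Ω' i.1.1 i.1.2) ?_
  intro i g y
  change Ω' i.1.1 i.1.2 (U.rho _ hν.galConj i.1.1 i.1.2 g y) = rho' _ _ (φ.symm g) (Ω' i.1.1 i.1.2 y)
  have key := hΩ' i.1.1 i.1.2 (φ.symm g) y
  rw [ContinuousMulEquiv.apply_symm_apply] at key
  exact key

end Generic

/-! ## §2 The face of record: transport to the conjugate space's own μ-uniform family -/

section HermConj

open Literature.RepresentationTheory.Liu2021 (isOscillatorChar_toHeckeCharacter_iff)

variable (F : CMField)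

/-- `f(−1) · (f(−1) · x) = x` for a monoid homomorphism `f` out of the units of a ring (`(−1)² = 1`). [folklore] -/
theorem map_negOne_mul_map_negOne_mul {R G : Type*} [Ring R] [Monoid G] (f : Rˣ →* G) (x : G) :
    f (-1) * (f (-1) * x) = x := by
  rw [← mul_assoc, ← map_mul, neg_one_mul, neg_neg, map_one, one_mul]

/-- **the representative section of the conjugate datum**: `rᶜ(ε′) := −r(locF(−1) · ε′)` — if `⟨r(ε)⟩` is the hermitian line of the
collection `ε`, then `⟨−r(−ε′)⟩` is a line of the collection `ε′` (`locF` is a homomorphism and `(−1)² = 1`), so `rᶜ` is again a FAITHFUL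
section ([Liu2021, Def. 4.11 second bullet, Def. 4.12]: the line attached to `−ε`). [cite: Liu2021, Def. 4.12 (l. 2102–2111), Rem. 4.4] -/
def repNegTwist (s : Rep ↥(maximalRealSubfield F) (imagUnitSq F)) : Rep ↥(maximalRealSubfield F) (imagUnitSq F) where
  toFun ε := -(s.toFun (locF ↥(maximalRealSubfield F) (imagUnitSq F) (-1) * ε))
  locF_toFun ε hε := by
    obtain ⟨a, rfl⟩ := hε
    rw [← neg_one_mul, map_mul, s.locF_toFun _ ⟨-1 * a, by rw [map_mul]⟩]
    exact map_negOne_mul_map_negOne_mul (G := Eps ↥(maximalRealSubfield F) (imagUnitSq F))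
      (locF ↥(maximalRealSubfield F) (imagUnitSq F)) _

/-- **the per-character sections of the conjugate datum**: `rᶜ_μ := repNegTwist (r_{μᶜ})`, so that `rᶜ_ν(ε′) = −r_{νᶜ}(−ε′)` — the sign
clause `hε` of Part V ∕ VI holds by `rfl`. [cite: Liu2021, Def. 4.12 (l. 2102–2111), Rem. 4.4] -/
def repConj (r : ∀ μ : Literature.NumberTheory.Automorphic.IdeleClassGroup F →ₜ* Circle,
      IdeleClassGroup.IsConjugateSymplectic F μ → Rep ↥(maximalRealSubfield F) (imagUnitSq F))
    (μ : Literature.NumberTheory.Automorphic.IdeleClassGroup F →ₜ* Circle) (hμ : IdeleClassGroup.IsConjugateSymplectic F μ) :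
    Rep ↥(maximalRealSubfield F) (imagUnitSq F) :=
  repNegTwist F (r (galConj (IsCMField.complexConj F) μ) hμ.galConj)

/-- **`ε ↦ −ε`** on the collections ([Liu2021, Def. 4.12, last sentence]: «`ε` is `μ`-admissible iff `−ε` is `μᶜ`-admissible»), as an
involutive permutation of `Eps` (both directions are `ε ↦ locF (−1) · ε`). [cite: Liu2021, Def. 4.12 (l. 2108–2111), Rem. 4.4] -/
def epsNegEquiv : Eps ↥(maximalRealSubfield F) (imagUnitSq F) ≃ Eps ↥(maximalRealSubfield F) (imagUnitSq F) where
  toFun ε := locF ↥(maximalRealSubfield F) (imagUnitSq F) (-1) * ε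
  invFun ε := locF ↥(maximalRealSubfield F) (imagUnitSq F) (-1) * ε
  left_inv ε := map_negOne_mul_map_negOne_mul (G := Eps ↥(maximalRealSubfield F) (imagUnitSq F)) (locF ↥(maximalRealSubfield F) (imagUnitSq F)) ε
  right_inv ε := map_negOne_mul_map_negOne_mul (G := Eps ↥(maximalRealSubfield F) (imagUnitSq F)) (locF ↥(maximalRealSubfield F) (imagUnitSq F)) ε

/-- **[Liu2021, Def. 4.12, last sentence] on the collection map of record**: for `x ∈ E^{×−}` (`x̄ = −x`, `x ≠ 0`) and a normaliser
`δ′ ∈ E^{×−}`, the collection of `−x` is `(−1) ·` the collection of `x`: `epsOf δ′ (−x) = locF (−1) · epsOf δ′ x` (`x = a·δ′` with `a ∈ F⁺ˣ`,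
✔ `epsOf_algebraMap_mul`). [cite: Liu2021, Def. 4.12 (l. 2102–2111), Rem. 4.4 (l. 1912–1933)] -/
theorem epsOf_neg_of_complexConj_eq_neg (δ' : F) (hδ'c : IsCMField.complexConj F δ' = -δ') (hδ'0 : δ' ≠ 0) (x : F)
    (hxc : IsCMField.complexConj F x = -x) (hx0 : x ≠ 0) :
    epsOf ↥(maximalRealSubfield F) (imagUnitSq F) F δ' (-x) =
      locF ↥(maximalRealSubfield F) (imagUnitSq F) (-1) * epsOf ↥(maximalRealSubfield F) (imagUnitSq F) F δ' x := by
  -- `x / δ′` is real: `x = a · δ′` with `a ∈ F⁺`, `a ≠ 0`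
  have hreal : IsCMField.complexConj F (x * δ'⁻¹) = x * δ'⁻¹ := by
    rw [map_mul, map_inv₀, hxc, hδ'c, neg_mul, inv_neg, mul_neg, neg_neg]
  have hmem : x * δ'⁻¹ ∈ maximalRealSubfield F := (IsCMField.complexConj_eq_self_iff F _).1 hreal
  have hne : (⟨x * δ'⁻¹, hmem⟩ : ↥(maximalRealSubfield F)) ≠ 0 := fun h0 =>
    (mul_ne_zero hx0 (inv_ne_zero hδ'0)) (congrArg Subtype.val h0)
  set a : (↥(maximalRealSubfield F))ˣ := Units.mk0 _ hne with ha
  have hx : x = algebraMap (↥(maximalRealSubfield F)) F (a : ↥(maximalRealSubfield F)) * δ' := by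
    show x = (x * δ'⁻¹) * δ'
    rw [inv_mul_cancel_right₀ hδ'0]
  have hnx : -x = algebraMap (↥(maximalRealSubfield F)) F ((-a : (↥(maximalRealSubfield F))ˣ) : ↥(maximalRealSubfield F)) * δ' := by
    rw [Units.val_neg, map_neg, neg_mul, ← hx]
  rw [hnx, epsOf_algebraMap_mul _ _ _ _ hδ'0, hx, epsOf_algebraMap_mul _ _ _ _ hδ'0, ← neg_one_mul a, map_mul]

/-- **FORWARD AT THE FACE OF RECORD**: the END's `hLiuC` row at `(V, ν)` (any tail `t`) implies [Liu2021, Thm. 4.18] AS PRINTED for the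
transported datum — group `𝔾_{V^{(c)}} = U(V^{(c)})(𝔸_{F⁺,f})` through `(adelicFinConj V)⁻¹`, Liu's own collections map `epsOf … δ′`, summands ∕
actions the conjugate space's μ-uniform family `𝕌_{V^{(c)}}` at `ν`.  §1 with `eε := epsNegEquiv`, `eχ := chiInv`, `hneg :=
epsOf_neg_of_complexConj_eq_neg`, and Part VI `exists_uniformOmegaRep_conj_hermConj` at `(ε, ε′, χ, χ′) := (−ε′, ε′, χ′⁻¹, χ′)`.
[cite: Liu2021, Thm. 4.18 (l. 2232–2245), Def. 4.11 (l. 2092–2096), Def. 4.12 (l. 2102–2111), Rem. 4.4, App. D Lem. D.1 (2) (l. 5231)] -/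
theorem thm418AsPrinted_muConj_rest_transport_hermConj (h : exists_recordSystem) [IsGalois ℚ F] (ι₁ : F →+* ℂ) (V : HermSpace3 F ι₁)
    (Φ Φ' : CMType F) {n : ℕ} (e : Fin 3 × Fin 1 ≃ Fin n) (dV : Fin 3 → F)
    (ιV : (sec42DataOf h isoOf F ι₁ V Φ).G →*
      UnitaryGroup.finAdelic ↥(maximalRealSubfield F) F (IsCMField.complexConj F) 3 (Matrix.diagonal dV))
    (δ' : F) (r : ∀ μ : Literature.NumberTheory.Automorphic.IdeleClassGroup F →ₜ* Circle,
      IdeleClassGroup.IsConjugateSymplectic F μ → Rep ↥(maximalRealSubfield F) (imagUnitSq F))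
    (hdV : ∀ i, IsCMField.complexConj F (dV i) = dV i) (hdV0 : ∀ i, dV i ≠ 0)
    (hJc : (Matrix.diagonal dV).map ((IsCMField.complexConj F : F ≃ₐ[↥(maximalRealSubfield F)] F) : F →+* F) = Matrix.diagonal dV)
    (hδ'c : IsCMField.complexConj F δ' = -δ') (hδ'0 : δ' ≠ 0)
    (ν : Literature.NumberTheory.Automorphic.IdeleClassGroup F →ₜ* Circle) (hν : IdeleClassGroup.IsConjugateSymplectic F ν)
    (t : RestTail (sec42DataOf h isoOf F ι₁ V Φ) ν hν)
    (hrow : Thm418AsPrinted (AppendixC.toThm418Data (sec42DataOf h isoOf F ι₁ V Φ)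
      ((AdapterMuConj.muConj (uniformOmegaRep h F ι₁ V Φ e dV hdV hdV0 ιV δ' r)).rest t))) :
    Thm418AsPrinted ((AppendixC.toThm418Data (sec42DataOf h isoOf F ι₁ V Φ)
      ((AdapterMuConj.muConj (uniformOmegaRep h F ι₁ V Φ e dV hdV hdV0 ιV δ' r)).rest t)).transport
      (sec42DataOf h isoOf F ι₁ V.conj Φ').G (HermSpace3.adelicFinConj V).symm
      (Eps ↥(maximalRealSubfield F) (imagUnitSq F)) (epsOf ↥(maximalRealSubfield F) (imagUnitSq F) F δ')
      (Chi ↥(maximalRealSubfield F) F (IsCMField.complexConj F))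
      ((uniformOmegaRep h F ι₁ V.conj Φ' e dV hdV hdV0 (iotaVConj h F ι₁ V Φ Φ' dV ιV hJc) δ' (repConj F r)).omega ν hν)
      ((uniformOmegaRep h F ι₁ V.conj Φ' e dV hdV hdV0 (iotaVConj h F ι₁ V Φ Φ' dV ιV hJc) δ' (repConj F r)).rho ν hν)) := by
  -- Part VI at every index `(ε′, χ′)`, read at `(ε, χ) := (locF (−1) · ε′, χ′⁻¹)`
  have key : ∀ (ε' : Eps ↥(maximalRealSubfield F) (imagUnitSq F)) (χ' : Chi ↥(maximalRealSubfield F) F (IsCMField.complexConj F)),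
      ∃ Ω : (uniformOmegaRep h F ι₁ V Φ e dV hdV hdV0 ιV δ' r).omega (galConj (IsCMField.complexConj F) ν) hν.galConj
          ((locF ↥(maximalRealSubfield F) (imagUnitSq F) (-1) * ε' : Eps ↥(maximalRealSubfield F) (imagUnitSq F))) (chiInv ↥(maximalRealSubfield F) F (IsCMField.complexConj F) χ') ≃ₗ[ℂ]
          (uniformOmegaRep h F ι₁ V.conj Φ' e dV hdV hdV0 (iotaVConj h F ι₁ V Φ Φ' dV ιV hJc) δ' (repConj F r)).omega ν hν ε' χ',
        ∀ (g : (sec42DataOf h isoOf F ι₁ V Φ).G)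
          (x : (uniformOmegaRep h F ι₁ V Φ e dV hdV hdV0 ιV δ' r).omega (galConj (IsCMField.complexConj F) ν) hν.galConj
            ((locF ↥(maximalRealSubfield F) (imagUnitSq F) (-1) * ε' : Eps ↥(maximalRealSubfield F) (imagUnitSq F))) (chiInv ↥(maximalRealSubfield F) F (IsCMField.complexConj F) χ')),
          Ω ((uniformOmegaRep h F ι₁ V Φ e dV hdV hdV0 ιV δ' r).rho (galConj (IsCMField.complexConj F) ν) hν.galConj
              ((locF ↥(maximalRealSubfield F) (imagUnitSq F) (-1) * ε' : Eps ↥(maximalRealSubfield F) (imagUnitSq F))) (chiInv ↥(maximalRealSubfield F) F (IsCMField.complexConj F) χ') g x) =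
            (uniformOmegaRep h F ι₁ V.conj Φ' e dV hdV hdV0 (iotaVConj h F ι₁ V Φ Φ' dV ιV hJc) δ' (repConj F r)).rho ν hν ε' χ'
              (phiConj h F ι₁ V Φ Φ' g) (Ω x) :=
    fun ε' χ' => exists_uniformOmegaRep_conj_hermConj h F ι₁ V Φ Φ' e dV ιV δ' r (repConj F r) hdV hdV0 hJc ν hν
      ((locF ↥(maximalRealSubfield F) (imagUnitSq F) (-1) * ε' : Eps ↥(maximalRealSubfield F) (imagUnitSq F))) ε' rfl
      (chiInv ↥(maximalRealSubfield F) F (IsCMField.complexConj F) χ') χ'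
      ((congrArg Subtype.val (chiInv_chiInv ↥(maximalRealSubfield F) F (IsCMField.complexConj F) χ')).symm.trans
        (chiInv_val ↥(maximalRealSubfield F) F (IsCMField.complexConj F) _))
  choose Ω hΩ using key
  -- the equivariance clause along `φ := (adelicFinConj V)⁻¹`: `phiConj ((adelicFinConj V)⁻¹ g′) = g′`
  have hΩ' : ∀ (ε' : Eps ↥(maximalRealSubfield F) (imagUnitSq F)) (χ' : Chi ↥(maximalRealSubfield F) F (IsCMField.complexConj F))
      (g' : (sec42DataOf h isoOf F ι₁ V.conj Φ').G)
      (x : (uniformOmegaRep h F ι₁ V Φ e dV hdV hdV0 ιV δ' r).omega (galConj (IsCMField.complexConj F) ν) hν.galConj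
        ((locF ↥(maximalRealSubfield F) (imagUnitSq F) (-1) * ε' : Eps ↥(maximalRealSubfield F) (imagUnitSq F)))
        (chiInv ↥(maximalRealSubfield F) F (IsCMField.complexConj F) χ')),
      Ω ε' χ' ((uniformOmegaRep h F ι₁ V Φ e dV hdV hdV0 ιV δ' r).rho (galConj (IsCMField.complexConj F) ν) hν.galConj
          ((locF ↥(maximalRealSubfield F) (imagUnitSq F) (-1) * ε' : Eps ↥(maximalRealSubfield F) (imagUnitSq F)))
          (chiInv ↥(maximalRealSubfield F) F (IsCMField.complexConj F) χ') ((HermSpace3.adelicFinConj V).symm g') x) =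
        (uniformOmegaRep h F ι₁ V.conj Φ' e dV hdV hdV0 (iotaVConj h F ι₁ V Φ Φ' dV ιV hJc) δ' (repConj F r)).rho ν hν ε' χ'
          g' (Ω ε' χ' x) := by
    intro ε' χ' g' x
    -- `phiConj (φ g′) = g′` at the type `𝔾_{V^{(c)}}` (term-mode `congrArg`: no rewriting inside the carriers)
    have hg : phiConj h F ι₁ V Φ Φ' ((HermSpace3.adelicFinConj V).symm g') = g' :=
      ContinuousMulEquiv.apply_symm_apply (HermSpace3.adelicFinConj V) g'
    exact (hΩ ε' χ' ((HermSpace3.adelicFinConj V).symm g') x).trans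
      (congrArg (fun y => (uniformOmegaRep h F ι₁ V.conj Φ' e dV hdV hdV0 (iotaVConj h F ι₁ V Φ Φ' dV ιV hJc) δ'
        (repConj F r)).rho ν hν ε' χ' y (Ω ε' χ' x)) hg)
  exact thm418AsPrinted_muConj_rest_transport (uniformOmegaRep h F ι₁ V Φ e dV hdV hdV0 ιV δ' r) t
    (sec42DataOf h isoOf F ι₁ V.conj Φ').G (HermSpace3.adelicFinConj V).symm
    (Eps ↥(maximalRealSubfield F) (imagUnitSq F)) (epsOf ↥(maximalRealSubfield F) (imagUnitSq F) F δ')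
    (Chi ↥(maximalRealSubfield F) F (IsCMField.complexConj F))
    ((uniformOmegaRep h F ι₁ V.conj Φ' e dV hdV hdV0 (iotaVConj h F ι₁ V Φ Φ' dV ιV hJc) δ' (repConj F r)).omega ν hν)
    ((uniformOmegaRep h F ι₁ V.conj Φ' e dV hdV hdV0 (iotaVConj h F ι₁ V Φ Φ' dV ιV hJc) δ' (repConj F r)).rho ν hν)
    (epsNegEquiv F)
    (Function.Involutive.toPerm (chiInv ↥(maximalRealSubfield F) F (IsCMField.complexConj F))
      (chiInv_chiInv ↥(maximalRealSubfield F) F (IsCMField.complexConj F)))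
    (fun x hx => epsOf_neg_of_complexConj_eq_neg F δ' hδ'c hδ'0 x hx.2.1 hx.1) Ω hΩ' hrow

/-- **BACKWARD AT THE FACE OF RECORD**: [Liu2021, Thm. 4.18] AS PRINTED for the conjugate space's transported datum implies the END's
`hLiuC` row at `(V, ν)`; Part VI at `(ε, ε′, χ, χ′) := (ε₀, −ε₀, χ₀, χ₀⁻¹)`, §1 `thm418AsPrinted_muConj_rest_of_transport`.
[cite: Liu2021, Thm. 4.18 (l. 2232–2245), Def. 4.11 (l. 2092–2096), Def. 4.12 (l. 2102–2111), Rem. 4.4, App. D Lem. D.1 (2) (l. 5231)] -/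
theorem thm418AsPrinted_muConj_rest_of_transport_hermConj (h : exists_recordSystem) [IsGalois ℚ F] (ι₁ : F →+* ℂ) (V : HermSpace3 F ι₁)
    (Φ Φ' : CMType F) {n : ℕ} (e : Fin 3 × Fin 1 ≃ Fin n) (dV : Fin 3 → F)
    (ιV : (sec42DataOf h isoOf F ι₁ V Φ).G →*
      UnitaryGroup.finAdelic ↥(maximalRealSubfield F) F (IsCMField.complexConj F) 3 (Matrix.diagonal dV))
    (δ' : F) (r : ∀ μ : Literature.NumberTheory.Automorphic.IdeleClassGroup F →ₜ* Circle,
      IdeleClassGroup.IsConjugateSymplectic F μ → Rep ↥(maximalRealSubfield F) (imagUnitSq F))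
    (hdV : ∀ i, IsCMField.complexConj F (dV i) = dV i) (hdV0 : ∀ i, dV i ≠ 0)
    (hJc : (Matrix.diagonal dV).map ((IsCMField.complexConj F : F ≃ₐ[↥(maximalRealSubfield F)] F) : F →+* F) = Matrix.diagonal dV)
    (hδ'c : IsCMField.complexConj F δ' = -δ') (hδ'0 : δ' ≠ 0)
    (ν : Literature.NumberTheory.Automorphic.IdeleClassGroup F →ₜ* Circle) (hν : IdeleClassGroup.IsConjugateSymplectic F ν)
    (t : RestTail (sec42DataOf h isoOf F ι₁ V Φ) ν hν)
    (h' : Thm418AsPrinted ((AppendixC.toThm418Data (sec42DataOf h isoOf F ι₁ V Φ)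
      ((AdapterMuConj.muConj (uniformOmegaRep h F ι₁ V Φ e dV hdV hdV0 ιV δ' r)).rest t)).transport
      (sec42DataOf h isoOf F ι₁ V.conj Φ').G (HermSpace3.adelicFinConj V).symm
      (Eps ↥(maximalRealSubfield F) (imagUnitSq F)) (epsOf ↥(maximalRealSubfield F) (imagUnitSq F) F δ')
      (Chi ↥(maximalRealSubfield F) F (IsCMField.complexConj F))
      ((uniformOmegaRep h F ι₁ V.conj Φ' e dV hdV hdV0 (iotaVConj h F ι₁ V Φ Φ' dV ιV hJc) δ' (repConj F r)).omega ν hν)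
      ((uniformOmegaRep h F ι₁ V.conj Φ' e dV hdV hdV0 (iotaVConj h F ι₁ V Φ Φ' dV ιV hJc) δ' (repConj F r)).rho ν hν))) :
    Thm418AsPrinted (AppendixC.toThm418Data (sec42DataOf h isoOf F ι₁ V Φ)
      ((AdapterMuConj.muConj (uniformOmegaRep h F ι₁ V Φ e dV hdV hdV0 ιV δ' r)).rest t)) := by
  -- Part VI at every index `(ε₀, χ₀)` of the `hLiuC` datum, read at `(ε′, χ′) := (locF (−1) · ε₀, χ₀⁻¹)`
  have key : ∀ (ε₀ : Eps ↥(maximalRealSubfield F) (imagUnitSq F)) (χ₀ : Chi ↥(maximalRealSubfield F) F (IsCMField.complexConj F)),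
      ∃ Ω' : (uniformOmegaRep h F ι₁ V Φ e dV hdV hdV0 ιV δ' r).omega (galConj (IsCMField.complexConj F) ν) hν.galConj ε₀ χ₀ ≃ₗ[ℂ]
          (uniformOmegaRep h F ι₁ V.conj Φ' e dV hdV hdV0 (iotaVConj h F ι₁ V Φ Φ' dV ιV hJc) δ' (repConj F r)).omega ν hν ((locF ↥(maximalRealSubfield F) (imagUnitSq F) (-1) * ε₀ : Eps ↥(maximalRealSubfield F) (imagUnitSq F))) (chiInv ↥(maximalRealSubfield F) F (IsCMField.complexConj F) χ₀),
        ∀ (g : (sec42DataOf h isoOf F ι₁ V Φ).G) (x : (uniformOmegaRep h F ι₁ V Φ e dV hdV hdV0 ιV δ' r).omega (galConj (IsCMField.complexConj F) ν) hν.galConj ε₀ χ₀),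
          Ω' ((uniformOmegaRep h F ι₁ V Φ e dV hdV hdV0 ιV δ' r).rho (galConj (IsCMField.complexConj F) ν) hν.galConj ε₀ χ₀ g x) =
            (uniformOmegaRep h F ι₁ V.conj Φ' e dV hdV hdV0 (iotaVConj h F ι₁ V Φ Φ' dV ιV hJc) δ' (repConj F r)).rho ν hν ((locF ↥(maximalRealSubfield F) (imagUnitSq F) (-1) * ε₀ : Eps ↥(maximalRealSubfield F) (imagUnitSq F))) (chiInv ↥(maximalRealSubfield F) F (IsCMField.complexConj F) χ₀) (phiConj h F ι₁ V Φ Φ' g) (Ω' x) :=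
    fun ε₀ χ₀ => exists_uniformOmegaRep_conj_hermConj h F ι₁ V Φ Φ' e dV ιV δ' r (repConj F r) hdV hdV0 hJc ν hν
      ε₀ ((locF ↥(maximalRealSubfield F) (imagUnitSq F) (-1) * ε₀ : Eps ↥(maximalRealSubfield F) (imagUnitSq F)))
      (congrArg (fun ε => -((r (galConj (IsCMField.complexConj F) ν) hν.galConj).toFun ε))
        (map_negOne_mul_map_negOne_mul (G := Eps ↥(maximalRealSubfield F) (imagUnitSq F)) (locF ↥(maximalRealSubfield F) (imagUnitSq F)) ε₀))
      χ₀ (chiInv ↥(maximalRealSubfield F) F (IsCMField.complexConj F) χ₀) (chiInv_val ↥(maximalRealSubfield F) F (IsCMField.complexConj F) χ₀)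
  choose Ω' hΩ' using key
  have hΩ'' : ∀ (ε₀ : Eps ↥(maximalRealSubfield F) (imagUnitSq F)) (χ₀ : Chi ↥(maximalRealSubfield F) F (IsCMField.complexConj F)) (g' : (sec42DataOf h isoOf F ι₁ V.conj Φ').G) (x : (uniformOmegaRep h F ι₁ V Φ e dV hdV hdV0 ιV δ' r).omega (galConj (IsCMField.complexConj F) ν) hν.galConj ε₀ χ₀),
      Ω' ε₀ χ₀ ((uniformOmegaRep h F ι₁ V Φ e dV hdV hdV0 ιV δ' r).rho (galConj (IsCMField.complexConj F) ν) hν.galConj ε₀ χ₀ ((HermSpace3.adelicFinConj V).symm g') x) =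
        (uniformOmegaRep h F ι₁ V.conj Φ' e dV hdV hdV0 (iotaVConj h F ι₁ V Φ Φ' dV ιV hJc) δ' (repConj F r)).rho ν hν ((locF ↥(maximalRealSubfield F) (imagUnitSq F) (-1) * ε₀ : Eps ↥(maximalRealSubfield F) (imagUnitSq F))) (chiInv ↥(maximalRealSubfield F) F (IsCMField.complexConj F) χ₀) g' (Ω' ε₀ χ₀ x) := by
    intro ε₀ χ₀ g' x
    have hg : phiConj h F ι₁ V Φ Φ' ((HermSpace3.adelicFinConj V).symm g') = g' :=
      ContinuousMulEquiv.apply_symm_apply (HermSpace3.adelicFinConj V) g'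
    exact (hΩ' ε₀ χ₀ ((HermSpace3.adelicFinConj V).symm g') x).trans
      (congrArg (fun y => (uniformOmegaRep h F ι₁ V.conj Φ' e dV hdV hdV0 (iotaVConj h F ι₁ V Φ Φ' dV ιV hJc) δ' (repConj F r)).rho ν hν ((locF ↥(maximalRealSubfield F) (imagUnitSq F) (-1) * ε₀ : Eps ↥(maximalRealSubfield F) (imagUnitSq F))) (chiInv ↥(maximalRealSubfield F) F (IsCMField.complexConj F) χ₀) y (Ω' ε₀ χ₀ x)) hg)
  exact thm418AsPrinted_muConj_rest_of_transport (uniformOmegaRep h F ι₁ V Φ e dV hdV hdV0 ιV δ' r) t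
    (sec42DataOf h isoOf F ι₁ V.conj Φ').G (HermSpace3.adelicFinConj V).symm
    (Eps ↥(maximalRealSubfield F) (imagUnitSq F)) (epsOf ↥(maximalRealSubfield F) (imagUnitSq F) F δ')
    (Chi ↥(maximalRealSubfield F) F (IsCMField.complexConj F))
    ((uniformOmegaRep h F ι₁ V.conj Φ' e dV hdV hdV0 (iotaVConj h F ι₁ V Φ Φ' dV ιV hJc) δ' (repConj F r)).omega ν hν)
    ((uniformOmegaRep h F ι₁ V.conj Φ' e dV hdV hdV0 (iotaVConj h F ι₁ V Φ Φ' dV ιV hJc) δ' (repConj F r)).rho ν hν)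
    (epsNegEquiv F)
    (Function.Involutive.toPerm (chiInv ↥(maximalRealSubfield F) F (IsCMField.complexConj F))
      (chiInv_chiInv ↥(maximalRealSubfield F) F (IsCMField.complexConj F)))
    (fun x hx => epsOf_neg_of_complexConj_eq_neg F δ' hδ'c hδ'0 x hx.2.1 hx.1) Ω' hΩ'' h'

/-- **THE END's `hLiuC` ROW ⇔ [Liu2021, Thm. 4.18] AS PRINTED AT THE CONJUGATE SPACE's TRANSPORTED DATUM** — the ω-side identity of the
μ ↦ μᶜ identification as a KERNEL `Iff` displayed by name (d2bridge-ref G60 §5 (R2)): for every face `(F, ι₁, V, Φ)`, frame `(e, dV, ιV)`,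
normaliser `δ′ ∈ E^{×−}`, sections `r`, conjugate-symplectic `ν` and tail `t`, the displayed row is EQUIVALENT to [Thm. 4.18] for the datum with
`U(V^{(c)})(𝔸_{F⁺,f})` acting natively, Liu's OWN collections map, and the CONJUGATE SPACE's own [Def. 4.11] family at the label `ν` (on the
frame of `V` through `ιVᶜ`).  Residue (print level): (α) frame, (β) [Def. 4.11] transcription, (γ) [Thm. 4.18]; space face = R10 ✔ + R6 ✔.
[cite: Liu2021, Thm. 4.18 (l. 2232–2245), Def. 4.11, Def. 4.12, Rem. 4.4, App. D Lem. D.1 (2) (l. 5231)] [cite: PlatonovRapinchuk1994, §5.1] -/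
theorem thm418AsPrinted_muConj_rest_iff_transport_hermConj (h : exists_recordSystem) [IsGalois ℚ F] (ι₁ : F →+* ℂ) (V : HermSpace3 F ι₁)
    (Φ Φ' : CMType F) {n : ℕ} (e : Fin 3 × Fin 1 ≃ Fin n) (dV : Fin 3 → F)
    (ιV : (sec42DataOf h isoOf F ι₁ V Φ).G →*
      UnitaryGroup.finAdelic ↥(maximalRealSubfield F) F (IsCMField.complexConj F) 3 (Matrix.diagonal dV))
    (δ' : F) (r : ∀ μ : Literature.NumberTheory.Automorphic.IdeleClassGroup F →ₜ* Circle,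
      IdeleClassGroup.IsConjugateSymplectic F μ → Rep ↥(maximalRealSubfield F) (imagUnitSq F))
    (hdV : ∀ i, IsCMField.complexConj F (dV i) = dV i) (hdV0 : ∀ i, dV i ≠ 0)
    (hJc : (Matrix.diagonal dV).map ((IsCMField.complexConj F : F ≃ₐ[↥(maximalRealSubfield F)] F) : F →+* F) = Matrix.diagonal dV)
    (hδ'c : IsCMField.complexConj F δ' = -δ') (hδ'0 : δ' ≠ 0)
    (ν : Literature.NumberTheory.Automorphic.IdeleClassGroup F →ₜ* Circle) (hν : IdeleClassGroup.IsConjugateSymplectic F ν)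
    (t : RestTail (sec42DataOf h isoOf F ι₁ V Φ) ν hν) :
    Thm418AsPrinted (AppendixC.toThm418Data (sec42DataOf h isoOf F ι₁ V Φ)
      ((AdapterMuConj.muConj (uniformOmegaRep h F ι₁ V Φ e dV hdV hdV0 ιV δ' r)).rest t)) ↔
    Thm418AsPrinted ((AppendixC.toThm418Data (sec42DataOf h isoOf F ι₁ V Φ)
      ((AdapterMuConj.muConj (uniformOmegaRep h F ι₁ V Φ e dV hdV hdV0 ιV δ' r)).rest t)).transport
      (sec42DataOf h isoOf F ι₁ V.conj Φ').G (HermSpace3.adelicFinConj V).symm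
      (Eps ↥(maximalRealSubfield F) (imagUnitSq F)) (epsOf ↥(maximalRealSubfield F) (imagUnitSq F) F δ')
      (Chi ↥(maximalRealSubfield F) F (IsCMField.complexConj F))
      ((uniformOmegaRep h F ι₁ V.conj Φ' e dV hdV hdV0 (iotaVConj h F ι₁ V Φ Φ' dV ιV hJc) δ' (repConj F r)).omega ν hν)
      ((uniformOmegaRep h F ι₁ V.conj Φ' e dV hdV hdV0 (iotaVConj h F ι₁ V Φ Φ' dV ιV hJc) δ' (repConj F r)).rho ν hν)) :=
  ⟨fun hrow => thm418AsPrinted_muConj_rest_transport_hermConj F h ι₁ V Φ Φ' e dV ιV δ' r hdV hdV0 hJc hδ'c hδ'0 ν hν t hrow,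
    fun h' => thm418AsPrinted_muConj_rest_of_transport_hermConj F h ι₁ V Φ Φ' e dV ιV δ' r hdV hdV0 hJc hδ'c hδ'0 ν hν t h'⟩


end HermConj

end Summit.HodgeConjecture.CorCM.D2Bridge.MuConjIdent

end
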